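import Mathlib.Analysis.SpecialFunctions.Complex.Circle
import Literature.Probability.RandomPlanarGeometry.JordanIndex
import Literature.Probability.RandomPlanarGeometry.JordanDomainProofs
import Literature.Probability.RandomPlanarGeometry.ConformalMapProofs
import Literature.Probability.RandomPlanarGeometry.ConformalMapRiemannProofs
import Literature.Probability.RandomPlanarGeometry.ConformalMapCaratheodoryProofs
import Literature.Probability.RandomPlanarGeometry.LoopWinding
import HarnessLib

/-!
# The index of a Jordan domain is `±1`; comparing two boundary loops of the same domain

Topic `Literature/Probability/RandomPlanarGeometry` (planar domains). Sequel of `JordanIndex.lean`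
(`JordanDomain.index z`, the winding number of the boundary loop about `z`: `≠ 0` on the domain,
`0` outside), towards the **orientation hypothesis** of Bollobás–Riordan's Lemma 14
(*Percolation* (2006), Ch. 7 p. 184; `tri_exists_discreteApprox`, whose Carleson datum
`triangleTurn a b c = ω` must be turned into "`∂Ω` is traversed anticlockwise", i.e.
`index = 1`). Three tools, all proved:

* `JordanDomain.exists_lift`, `JordanDomain.index_eq_mul_index` — **two boundary loops of the
  same domain differ by a circle homeomorphism of degree `±1`**: if `D₁.carrier = D₂.carrier`
  there is `σ`, continuous and strictly monotone on `[0, 1]`, with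
  `D₂.boundary (σ t) = D₁.boundary t` and `σ 1 = σ 0 ± 1`; accordingly
  `D₁.index z = ± D₂.index z` (lift `t ↦ e^{2πi h(t)}` through `exp`, `h` the composite of the
  two circle homeomorphisms `ℝ/ℤ ≃ ∂D`; logarithms along `ℝ` of the periodic loop).
* `JordanDomain.wind_boundary_extension` — **the boundary loop of the Carathéodory extension `Φ`
  of a conformal map `φ : 𝔻 → D` winds once about `φ 0`**: the loops `t ↦ Φ(r e^{2πit}) - φ 0`,
  `r ∈ [ρ, 1]`, are a free homotopy in `ℂ ∖ {0}` (`Φ` is injective on the closed disc), and for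
  small `ρ` the loop is a perturbation of `φ'(0) ρ e^{2πit}` of winding number `1` (Rouché,
  `φ'(0) ≠ 0`); `JordanDomain.exists_ofDiscMap` re-parametrises `D` by `t ↦ Φ (e^{2πit})`,
  a loop of index `1` (`index_eq_one_of_boundary_eq`).
* `JordanDomain.index_eq_one_or_eq_neg_one` — **`D.index z = 1 ∨ D.index z = -1` for
  `z ∈ D`** (Riemann mapping theorem + Carathéodory + the two items above). Classically part of
  the Jordan curve theorem (the index of a Jordan curve about an interior point is `±1`).

## References

* B. Bollobás, O. Riordan, *Percolation*, Cambridge University Press (2006), Ch. 7, Lemma 14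
  p. 184 (anticlockwise marking).
* Ch. Pommerenke, *Boundary Behaviour of Conformal Maps* (1992), Thm. 2.6 (Carathéodory).

## Mathlib / tree

Mathlib: `AddCircle.toCircle`, `ContinuousOn.strictMonoOn_of_injOn_Ioo`,
`intermediate_value_Ioo`, `HasDerivAt`, `Complex.exp_eq_exp_iff_exists_int`. Tree:
`JordanIndex.lean` (`index`, `circleHomeo`, `param_circleHomeo`, `index_eq_of_mem_carrier`),
`WindingNumber.lean` (`wind`, `wind_spec`, `hasLogOn_univ`, `hasLogOn_Icc`,
`wind_eq_of_norm_sub_lt`, `wind_circleLoop_zero`, `wind_mul`), `LoopWinding.lean`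
(`wind_eq_of_homotopy`), `ConformalMapRiemannProofs.lean` (`exists_conformalEquiv_ball_holds`),
`ConformalMapCaratheodoryProofs.lean` (`exists_continuousOn_extension_holds`),
`ConformalMapProofs.lean` (`deriv_ne_zero_holds`), `JordanDomainProofs.lean`
(`isSimplyConnected_carrier`).
-/

noncomputable section

open Set Filter Topology Metric Complex
open Literature.Topology.PlaneTopology Literature.Topology.PlaneTopology.JordanCurveProof

namespace Literature.Probability.RandomPlanarGeometry

namespace JordanDomain

/-! ### Elementary facts about boundary loops -/

/-- Equal boundary values have parameters differing by an integer. [folklore] -/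
theorem exists_int_of_boundary_eq (D : JordanDomain) {s t : ℝ} (h : D.boundary s = D.boundary t) :
    ∃ n : ℤ, s = t + n := by
  have hfr : Int.fract s = Int.fract t :=
    D.injOn_boundary ⟨Int.fract_nonneg s, Int.fract_lt_one s⟩ ⟨Int.fract_nonneg t, Int.fract_lt_one t⟩
      (by rw [D.boundary_fract, D.boundary_fract, h])
  refine ⟨⌊s⌋ - ⌊t⌋, ?_⟩
  have hs := Int.fract_add_floor s
  have ht := Int.fract_add_floor t
  push_cast
  linarith

/-- The boundary loop misses the points off the frontier. [folklore] -/
theorem boundary_sub_ne_zero (D : JordanDomain) {z : ℂ} (hz : z ∉ frontier D.carrier) (t : ℝ) :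
    D.boundary t - z ≠ 0 := fun h => hz (sub_eq_zero.1 h ▸ D.boundary_mem_frontier t)

/-- A strictly monotone function on the open interval, continuous on the closed interval, is
strictly monotone on the closed interval. [folklore] -/
theorem strictMonoOn_Icc_of_Ioo {f : ℝ → ℝ} {a b : ℝ} (hab : a < b) (hc : ContinuousOn f (Icc a b))
    (hm : StrictMonoOn f (Ioo a b)) : StrictMonoOn f (Icc a b) := by
  -- the endpoint values are the one-sided limits
  have hleft : ∀ t ∈ Ioo a b, f a ≤ f t := by
    intro t ht
    have hlim : Tendsto f (𝓝[Ioo a t] a) (𝓝 (f a)) := by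
      have h1 : ContinuousWithinAt f (Icc a b) a := hc a (left_mem_Icc.2 hab.le)
      exact (h1.mono fun u hu => ⟨hu.1.le, hu.2.le.trans ht.2.le⟩).tendsto
    haveI : (𝓝[Ioo a t] a).NeBot := left_nhdsWithin_Ioo_neBot ht.1
    refine le_of_tendsto hlim ?_
    filter_upwards [self_mem_nhdsWithin] with u hu
    exact (hm ⟨hu.1, hu.2.trans ht.2⟩ ht hu.2).le
  have hright : ∀ t ∈ Ioo a b, f t ≤ f b := by
    intro t ht
    have hlim : Tendsto f (𝓝[Ioo t b] b) (𝓝 (f b)) := by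
      have h1 : ContinuousWithinAt f (Icc a b) b := hc b (right_mem_Icc.2 hab.le)
      exact (h1.mono fun u hu => ⟨ht.1.le.trans hu.1.le, hu.2.le⟩).tendsto
    haveI : (𝓝[Ioo t b] b).NeBot := right_nhdsWithin_Ioo_neBot ht.2
    refine ge_of_tendsto hlim ?_
    filter_upwards [self_mem_nhdsWithin] with u hu
    exact (hm ht ⟨ht.1.trans hu.1, hu.2⟩ hu.1).le
  intro s hs t ht hst
  rcases hs.1.eq_or_lt with has | has
  · -- `s = a`
    rw [← has]
    rcases ht.2.eq_or_lt with htb | htb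
    · -- `t = b`: through two intermediate points
      rw [htb]
      have hm₁ : (a + b) / 2 ∈ Ioo a b := ⟨by linarith, by linarith⟩
      have hm₂ : (a + (a + b) / 2) / 2 ∈ Ioo a b := ⟨by linarith, by linarith⟩
      calc f a ≤ f ((a + (a + b) / 2) / 2) := hleft _ hm₂
        _ < f ((a + b) / 2) := hm hm₂ hm₁ (by linarith)
        _ ≤ f b := hright _ hm₁
    · have hat : a < t := by rw [has]; exact hst
      have hm₁ : (a + t) / 2 ∈ Ioo a b := ⟨by linarith, by linarith⟩
      calc f a ≤ f ((a + t) / 2) := hleft _ hm₁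
        _ < f t := hm hm₁ ⟨hat, htb⟩ (by linarith)
  · rcases ht.2.eq_or_lt with htb | htb
    · rw [htb]
      have hsb : s < b := by rw [← htb]; exact hst
      have hm₁ : (s + b) / 2 ∈ Ioo a b := ⟨by linarith, by linarith⟩
      calc f s < f ((s + b) / 2) := hm ⟨has, hsb⟩ hm₁ (by linarith)
        _ ≤ f b := hright _ hm₁
    · exact hm ⟨has, hst.trans htb⟩ ⟨has.trans hst, htb⟩ hst

/-- The antitone version of `strictMonoOn_Icc_of_Ioo`. [folklore] -/
theorem strictAntiOn_Icc_of_Ioo {f : ℝ → ℝ} {a b : ℝ} (hab : a < b) (hc : ContinuousOn f (Icc a b))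
    (hm : StrictAntiOn f (Ioo a b)) : StrictAntiOn f (Icc a b) := by
  have h := strictMonoOn_Icc_of_Ioo (f := fun t => -f t) hab hc.neg fun s hs t ht hst => neg_lt_neg (hm hs ht hst)
  intro s hs t ht hst
  have := h hs ht hst
  simpa using this

/-! ### Lifting one boundary loop through another -/

variable (D₁ D₂ : JordanDomain)

/-- **Two boundary loops of the same Jordan domain differ by a circle homeomorphism of degree
`±1`.** If `D₁` and `D₂` have the same carrier (hence the same frontier), there is a map `σ`,
continuous on `[0, 1]`, with `D₂.boundary (σ t) = D₁.boundary t` on `[0, 1]`, which is either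
strictly increasing with `σ 1 = σ 0 + 1` or strictly decreasing with `σ 1 = σ 0 - 1`. (Lift the
composite `ℝ → ℝ/ℤ` of the circle homeomorphisms of the two loops through `t ↦ e^{2πit}` by a
continuous logarithm.) [folklore] -/
theorem exists_lift (h : D₁.carrier = D₂.carrier) :
    ∃ σ : ℝ → ℝ, ContinuousOn σ (Icc 0 1) ∧ (∀ t ∈ Icc (0 : ℝ) 1, D₂.boundary (σ t) = D₁.boundary t) ∧
      ((StrictMonoOn σ (Icc 0 1) ∧ σ 1 = σ 0 + 1) ∨ (StrictAntiOn σ (Icc 0 1) ∧ σ 1 = σ 0 - 1)) := by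
  haveI : Fact ((0 : ℝ) < 1) := ⟨one_pos⟩
  have hf : frontier D₁.carrier = frontier D₂.carrier := by rw [h]
  -- the composite circle map `k : ℝ → ℝ/ℤ`
  set k : ℝ → AddCircle (1 : ℝ) := fun t =>
    D₂.circleHomeo.symm ⟨D₁.boundary t, hf ▸ D₁.boundary_mem_frontier t⟩ with hk
  have hkc : Continuous k :=
    D₂.circleHomeo.symm.continuous.comp (D₁.continuous_boundary.subtype_mk _)
  have hkey : ∀ t, ((D₂.circleHomeo (k t) : frontier D₂.carrier) : ℂ) = D₁.boundary t := fun t => by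
    simp [hk]
  have hk2 : ∀ s, D₂.boundary s = ((D₂.circleHomeo (s : AddCircle (1 : ℝ)) : frontier D₂.carrier) : ℂ) :=
    fun s => (D₂.param_circleHomeo s).symm
  -- `W t = e^{2πi k(t)}` and its logarithm
  set W : ℝ → ℂ := fun t => ((AddCircle.toCircle (k t) : Circle) : ℂ) with hW
  have hWc : Continuous W := continuous_subtype_val.comp (AddCircle.continuous_toCircle.comp hkc)
  have hWne : ∀ t, W t ≠ 0 := fun t => (AddCircle.toCircle (k t)).coe_ne_zero
  obtain ⟨l, hlc, hle⟩ := hasLogOn_Icc hWc.continuousOn fun t _ => hWne t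
  set σ : ℝ → ℝ := fun t => (l t).im / (2 * Real.pi) with hσ
  have hσc : ContinuousOn σ (Icc 0 1) :=
    (Complex.continuous_im.comp_continuousOn hlc).div_const _
  -- `σ` lifts `k`
  have hlift : ∀ t ∈ Icc (0 : ℝ) 1, ((σ t : ℝ) : AddCircle (1 : ℝ)) = k t := by
    intro t ht
    obtain ⟨s, hs⟩ := QuotientAddGroup.mk_surjective (k t)
    have h1 : exp (l t) = exp ((2 * Real.pi * s : ℝ) * I) := by
      rw [hle t ht]
      show ((AddCircle.toCircle (k t) : Circle) : ℂ) = _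
      rw [← hs, AddCircle.toCircle_apply_mk, Circle.coe_exp]
      congr 1; push_cast; ring
    obtain ⟨m, hm⟩ := Complex.exp_eq_exp_iff_exists_int.1 h1
    have him : (l t).im = 2 * Real.pi * (s + m) := by
      rw [hm]
      simp only [add_im, mul_im, ofReal_re, ofReal_im, I_re, I_im, mul_zero, mul_one, zero_add,
        intCast_re, intCast_im, mul_re, add_zero, zero_mul, sub_zero]
      rw [show (2 : ℂ).re = 2 by norm_num]; ring
    have hσt : σ t = s + m := by
      show (l t).im / (2 * Real.pi) = s + m
      rw [him]; field_simp
    rw [hσt, ← hs]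
    rw [coe_eq_coe_iff_exists_int]
    exact ⟨-m, by push_cast; ring⟩
  have hbd : ∀ t ∈ Icc (0 : ℝ) 1, D₂.boundary (σ t) = D₁.boundary t := fun t ht => by
    rw [hk2, hlift t ht, hkey]
  -- parameters with the same class have the same `D₁`-boundary value
  have hsame : ∀ s ∈ Icc (0 : ℝ) 1, ∀ t ∈ Icc (0 : ℝ) 1, (∃ m : ℤ, σ s = σ t + m) →
      D₁.boundary s = D₁.boundary t := by
    rintro s hs t ht ⟨m, hm⟩
    have hcl : ((σ s : ℝ) : AddCircle (1 : ℝ)) = σ t := by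
      rw [coe_eq_coe_iff_exists_int]; exact ⟨-m, by rw [hm]; push_cast; ring⟩
    rw [← hkey s, ← hkey t, ← hlift s hs, ← hlift t ht, hcl]
  -- injectivity on `[0, 1)`, strict monotonicity
  have hinj : InjOn σ (Ioo 0 1) := by
    intro s hs t ht hst
    have := hsame s (Ioo_subset_Icc_self hs) t (Ioo_subset_Icc_self ht) ⟨0, by simp [hst]⟩
    exact D₁.injOn_boundary ⟨hs.1.le, hs.2⟩ ⟨ht.1.le, ht.2⟩ this
  have hper : ∃ m : ℤ, σ 1 = σ 0 + m := by
    have hk10 : k 1 = k 0 := by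
      simp only [hk]
      congr 1
      apply Subtype.ext
      have := D₁.periodic_boundary 0
      rw [zero_add] at this
      exact this
    have h10 : ((σ 1 : ℝ) : AddCircle (1 : ℝ)) = σ 0 := by
      rw [hlift 1 ⟨zero_le_one, le_rfl⟩, hlift 0 ⟨le_rfl, zero_le_one⟩, hk10]
    obtain ⟨m, hm⟩ := coe_eq_coe_iff_exists_int.1 h10.symm
    exact ⟨m, hm⟩
  obtain ⟨m, hm⟩ := hper
  -- no parameter of `(0, 1)` is congruent to `σ 0` modulo `ℤ`
  have hnot : ∀ t ∈ Ioo (0 : ℝ) 1, ∀ j : ℤ, σ t ≠ σ 0 + j := by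
    intro t ht j hj
    have := hsame t (Ioo_subset_Icc_self ht) 0 ⟨le_rfl, zero_le_one⟩ ⟨j, hj⟩
    have h0 := D₁.injOn_boundary ⟨ht.1.le, ht.2⟩ ⟨le_rfl, zero_lt_one⟩ this
    exact ht.1.ne' h0
  refine ⟨σ, hσc, hbd, ?_⟩
  rcases hσc.mono Ioo_subset_Icc_self |>.strictMonoOn_of_injOn_Ioo zero_lt_one hinj with hmono | hanti
  · have hmono' := strictMonoOn_Icc_of_Ioo zero_lt_one hσc hmono
    refine Or.inl ⟨hmono', ?_⟩
    have hlt : σ 0 < σ 1 := hmono' ⟨le_rfl, zero_le_one⟩ ⟨zero_le_one, le_rfl⟩ zero_lt_one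
    have hm1 : (1 : ℤ) ≤ m := by
      have : (0 : ℝ) < m := by linarith
      have : (0 : ℤ) < m := by exact_mod_cast this
      omega
    rcases hm1.eq_or_lt with hm1 | hm2
    · rw [hm, ← hm1]; simp
    · exfalso
      have hmem : σ 0 + 1 ∈ Ioo (σ 0) (σ 1) := by
        have : (2 : ℝ) ≤ m := by exact_mod_cast hm2
        exact ⟨by linarith, by linarith⟩
      obtain ⟨t, ht, hteq⟩ := intermediate_value_Ioo zero_le_one hσc hmem
      exact hnot t ht 1 (by rw [hteq]; simp)
  · have hanti' := strictAntiOn_Icc_of_Ioo zero_lt_one hσc hanti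
    refine Or.inr ⟨hanti', ?_⟩
    have hlt : σ 1 < σ 0 := hanti' ⟨le_rfl, zero_le_one⟩ ⟨zero_le_one, le_rfl⟩ zero_lt_one
    have hm1 : m ≤ -1 := by
      have : (m : ℝ) < 0 := by linarith
      have : m < 0 := by exact_mod_cast this
      omega
    rcases hm1.eq_or_lt with hm1 | hm2
    · rw [hm, hm1]; simp [sub_eq_add_neg]
    · exfalso
      have hmem : σ 0 - 1 ∈ Ioo (σ 1) (σ 0) := by
        have : (m : ℝ) ≤ -2 := by exact_mod_cast (show m ≤ -2 by omega)
        exact ⟨by linarith, by linarith⟩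
      obtain ⟨t, ht, hteq⟩ := intermediate_value_Ioo' zero_le_one hσc hmem
      exact hnot t ht (-1) (by rw [hteq]; simp [sub_eq_add_neg])

/-- **The indices of two boundary loops of the same domain agree up to the degree of the lift**:
if `D₂.boundary (σ t) = D₁.boundary t` on `[0, 1]` with `σ` continuous and `σ 1 = σ 0 + n`, then
`D₁.index z = n · D₂.index z` for `z` off the frontier (a logarithm `L` of `D₂.boundary - z` along
`ℝ` satisfies `L (s + 1) = L s + 2πi · D₂.index z`, and `L ∘ σ` is a logarithm of
`D₁.boundary - z` on `[0, 1]`). [folklore] -/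
theorem index_eq_mul_index {σ : ℝ → ℝ} (hσc : ContinuousOn σ (Icc 0 1))
    (hσ : ∀ t ∈ Icc (0 : ℝ) 1, D₂.boundary (σ t) = D₁.boundary t) {n : ℤ} (hn : σ 1 = σ 0 + n)
    {z : ℂ} (hz : z ∉ frontier D₂.carrier) : D₁.index z = n * D₂.index z := by
  set f : ℝ → ℂ := fun s => D₂.boundary s - z with hf
  have hfc : Continuous f := D₂.continuous_boundary.sub continuous_const
  have hfne : ∀ s, f s ≠ 0 := D₂.boundary_sub_ne_zero hz
  obtain ⟨L, hLc, hLe⟩ := hasLogOn_univ isSimplyConnected_univ_real hfc hfne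
  have hLc' : Continuous L := continuousOn_univ.1 hLc
  -- the shift by one period adds `2πi N`
  obtain ⟨N, hN⟩ : ∃ N : ℤ, ∀ s, L (s + 1) = L s + N * (2 * Real.pi * I) := by
    obtain ⟨N, hN⟩ := exists_int_eq_add_of_exp_eq isPreconnected_univ
      (hLc'.comp (continuous_id.add continuous_const)).continuousOn hLc
      (fun s _ => by
        show exp (L (s + 1)) = exp (L s)
        rw [hLe _ (mem_univ _), hLe _ (mem_univ _), hf]
        simp only
        rw [D₂.periodic_boundary])
    exact ⟨N, fun s => hN s (mem_univ _)⟩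
  have hNw : N = D₂.index z := by
    have h := wind_spec (f := f) (l := L) hLc'.continuousOn (fun t _ => hLe t (mem_univ _))
      (by show D₂.boundary 0 - z = D₂.boundary 1 - z; rw [← D₂.periodic_boundary 0, zero_add])
    have h1 := hN 0
    rw [zero_add] at h1
    apply int_eq_of_mul_two_pi_I_eq
    have : L 1 - L 0 = N * (2 * Real.pi * I) := by rw [h1]; ring
    rw [← this, h]
    rfl
  -- shifting by `m` periods
  have hshiftN : ∀ (m : ℕ) (s : ℝ), L (s + m) = L s + m * N * (2 * Real.pi * I) := by
    intro m
    induction m with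
    | zero => intro s; simp
    | succ m ih =>
      intro s
      have e : s + ((m + 1 : ℕ) : ℝ) = (s + m) + 1 := by push_cast; ring
      rw [e, hN, ih]; push_cast; ring
  have hshift : ∀ (m : ℤ) (s : ℝ), L (s + m) = L s + m * N * (2 * Real.pi * I) := by
    intro m s
    obtain ⟨j, rfl | rfl⟩ := m.eq_nat_or_neg
    · have := hshiftN j s
      push_cast at this ⊢
      exact this
    · have := hshiftN j (s + ((-(j : ℤ) : ℤ) : ℝ))
      have e : s + ((-(j : ℤ) : ℤ) : ℝ) + (j : ℝ) = s := by push_cast; ring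
      rw [e] at this
      push_cast at this ⊢
      linear_combination -this
  -- `L ∘ σ` is a logarithm of `D₁.boundary - z` on `[0, 1]`
  have h1 := wind_spec (f := fun t => D₁.boundary t - z) (l := fun t => L (σ t))
    (hLc'.comp_continuousOn hσc) (fun t ht => by
      show exp (L (σ t)) = D₁.boundary t - z
      rw [hLe _ (mem_univ _), hf]; simp only; rw [hσ t ht])
    (by show D₁.boundary 0 - z = D₁.boundary 1 - z; rw [← D₁.periodic_boundary 0, zero_add])
  have h2 : L (σ 1) - L (σ 0) = (n * N : ℤ) * (2 * Real.pi * I) := by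
    rw [hn, hshift n (σ 0)]; push_cast; ring
  have h3 := int_eq_of_mul_two_pi_I_eq (h2.symm.trans h1)
  rw [show D₁.index z = wind (fun t => D₁.boundary t - z) from rfl, ← h3, hNw]

/-! ### The boundary loop of the Carathéodory extension winds once -/

/-- Scaling the unit circle loop gives the circle loop of radius `r`. [folklore] -/
theorem ofReal_mul_circleLoop (r t : ℝ) : (r : ℂ) * circleLoop 0 1 t = circleLoop 0 r t := by
  rw [circleLoop_apply, circleLoop_apply]; simp

/-- The unit circle loop has norm one. [folklore] -/
theorem norm_circleLoop_zero_one (t : ℝ) : ‖circleLoop 0 1 t‖ = 1 := by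
  simpa using norm_circleLoop_sub_center 0 1 t

/-- **The boundary loop of the Carathéodory extension of a conformal map of the disc winds once
about the image of the centre.** Let `φ : 𝔻 → D` be a conformal equivalence and `Φ` a map
continuous and injective on the closed disc extending `φ`; then
`wind (t ↦ Φ (e^{2πit}) - φ 0) = 1`: the loops `t ↦ Φ (r e^{2πit}) - φ 0`, `ρ ≤ r ≤ 1`, are a
free homotopy in `ℂ ∖ {0}` by injectivity, and for `ρ` small `φ (ρ e^{2πit}) - φ 0` is within
`‖φ'(0)‖ ρ / 2` of `φ'(0) ρ e^{2πit}`, a loop of winding number `1` (`φ'(0) ≠ 0`). [folklore] -/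
theorem wind_boundary_extension (D : JordanDomain) (φ : ConformalEquiv (ball (0 : ℂ) 1) D.carrier)
    {Φ : ℂ → ℂ} (hc : ContinuousOn Φ (closedBall 0 1)) (he : EqOn Φ φ (ball 0 1))
    (hi : InjOn Φ (closedBall 0 1)) :
    wind (fun t => Φ (circleLoop 0 1 t) - φ 0) = 1 := by
  have h0 : (0 : ℂ) ∈ ball (0 : ℂ) 1 := mem_ball_self one_pos
  set f' : ℂ := deriv φ 0 with hf'
  have hf'ne : f' ≠ 0 := ConformalEquiv.deriv_ne_zero_holds φ isOpen_ball h0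
  have hd : HasDerivAt φ f' 0 :=
    ((φ.differentiableOn 0 h0).differentiableAt (isOpen_ball.mem_nhds h0)).hasDerivAt
  -- the first-order estimate on a small circle
  have hc2 : (0 : ℝ) < ‖f'‖ / 2 := by positivity
  have hest := (hasDerivAt_iff_isLittleO.1 hd).def hc2
  rw [Metric.eventually_nhds_iff] at hest
  obtain ⟨ρ₀, hρ₀, hρ₀est⟩ := hest
  set ρ : ℝ := min (ρ₀ / 2) (1 / 2) with hρ
  have hρpos : 0 < ρ := by positivity
  have hρ1 : ρ < 1 := (min_le_right _ _).trans_lt (by norm_num)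
  have hρρ₀ : ρ < ρ₀ := (min_le_left _ _).trans_lt (by linarith)
  -- the free homotopy `H s t = Φ ((ρ + s (1 - ρ)) e^{2πit}) - φ 0`
  set H : ℝ → ℝ → ℂ := fun s t => Φ (((ρ + s * (1 - ρ) : ℝ) : ℂ) * circleLoop 0 1 t) - φ 0 with hH
  have hrad : ∀ s ∈ Icc (0 : ℝ) 1, ρ ≤ ρ + s * (1 - ρ) ∧ ρ + s * (1 - ρ) ≤ 1 := fun s hs =>
    ⟨by nlinarith [hs.1], by nlinarith [hs.2]⟩
  have hnorm : ∀ s t : ℝ, ‖((ρ + s * (1 - ρ) : ℝ) : ℂ) * circleLoop 0 1 t‖ = |ρ + s * (1 - ρ)| := by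
    intro s t; rw [norm_mul, Complex.norm_real, Real.norm_eq_abs, norm_circleLoop_zero_one, mul_one]
  have hmaps : ∀ p ∈ Icc (0 : ℝ) 1 ×ˢ Icc (0 : ℝ) 1,
      ((ρ + p.1 * (1 - ρ) : ℝ) : ℂ) * circleLoop 0 1 p.2 ∈ closedBall (0 : ℂ) 1 := by
    rintro ⟨s, t⟩ ⟨hs, -⟩
    rw [mem_closedBall, dist_zero_right, hnorm]
    have := hrad s hs
    rw [abs_of_pos (hρpos.trans_le this.1)]; exact this.2
  have hHc : ContinuousOn (fun p : ℝ × ℝ => H p.1 p.2) (Icc 0 1 ×ˢ Icc 0 1) := by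
    have hin : Continuous fun p : ℝ × ℝ => ((ρ + p.1 * (1 - ρ) : ℝ) : ℂ) * circleLoop 0 1 p.2 := by
      have := continuous_circleLoop 0 1
      fun_prop
    exact (hc.comp hin.continuousOn hmaps).sub continuousOn_const
  have hΦ0 : Φ 0 = φ 0 := he h0
  have hne : ∀ s ∈ Icc (0 : ℝ) 1, ∀ t ∈ Icc (0 : ℝ) 1, H s t ≠ 0 := by
    intro s hs t ht hzero
    have hw : ((ρ + s * (1 - ρ) : ℝ) : ℂ) * circleLoop 0 1 t ∈ closedBall (0 : ℂ) 1 := hmaps (s, t) ⟨hs, ht⟩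
    have heq : Φ (((ρ + s * (1 - ρ) : ℝ) : ℂ) * circleLoop 0 1 t) = Φ 0 := by
      rw [hΦ0]; exact sub_eq_zero.1 hzero
    have := hi hw (mem_closedBall_self zero_le_one) heq
    have hn := congrArg (fun w : ℂ => ‖w‖) this
    simp only [norm_zero] at hn
    rw [hnorm] at hn
    have := hrad s hs
    rw [abs_of_pos (hρpos.trans_le this.1)] at hn
    linarith
  have hloop : ∀ s ∈ Icc (0 : ℝ) 1, H s 0 = H s 1 := fun s _ => by
    simp only [hH, circleLoop_zero_eq]
  have hhom := wind_eq_of_homotopy H hHc hne hloop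
  -- the end `s = 1` is the boundary loop
  have hH1 : EqOn (H 1) (fun t => Φ (circleLoop 0 1 t) - φ 0) (Icc 0 1) := fun t _ => by
    simp [hH]
  -- the end `s = 0` is the small circle, a perturbation of `f' ρ e^{2πit}`
  have hH0 : EqOn (H 0) (fun t => φ (circleLoop 0 ρ t) - φ 0) (Icc 0 1) := fun t _ => by
    simp only [hH, zero_mul, add_zero, ofReal_mul_circleLoop]
    rw [he]
    rw [mem_ball, dist_zero_right]
    have := circleLoop_mem_sphere 0 hρpos.le t
    rw [mem_sphere, dist_zero_right] at this
    rw [this]; exact hρ1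
  have hg : IsNonvanishingLoop fun t => f' * circleLoop 0 ρ t :=
    (IsNonvanishingLoop.const hf'ne).mul (isNonvanishingLoop_circleLoop (by rw [norm_zero, abs_of_pos hρpos]; exact hρpos.ne))
  have hsmall : wind (fun t => φ (circleLoop 0 ρ t) - φ 0) = wind (fun t => f' * circleLoop 0 ρ t) := by
    have hloop0 : IsNonvanishingLoop (H 0) :=
      ⟨hHc.comp (f := fun t : ℝ => ((0 : ℝ), t)) (Continuous.continuousOn (by fun_prop))
          fun t ht => ⟨⟨le_rfl, zero_le_one⟩, ht⟩,
        fun t ht => hne 0 ⟨le_rfl, zero_le_one⟩ t ht, hloop 0 ⟨le_rfl, zero_le_one⟩⟩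
    have hloop0' := hloop0.congr hH0
    refine wind_eq_of_norm_sub_lt hloop0'.continuousOn hloop0'.eq_endpoints hg fun t _ => ?_
    have hx : circleLoop 0 ρ t ∈ ball (0 : ℂ) ρ₀ := by
      rw [mem_ball, dist_zero_right]
      have := circleLoop_mem_sphere 0 hρpos.le t
      rw [mem_sphere, dist_zero_right] at this
      rw [this]; exact hρρ₀
    have h1 := hρ₀est hx
    simp only [sub_zero, smul_eq_mul] at h1
    have hn : ‖circleLoop 0 ρ t‖ = ρ := by
      have := circleLoop_mem_sphere 0 hρpos.le t
      rwa [mem_sphere, dist_zero_right] at this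
    rw [norm_mul, hn]
    calc ‖φ (circleLoop 0 ρ t) - φ 0 - f' * circleLoop 0 ρ t‖
        = ‖φ (circleLoop 0 ρ t) - φ 0 - circleLoop 0 ρ t * f'‖ := by rw [mul_comm]
      _ ≤ ‖f'‖ / 2 * ‖circleLoop 0 ρ t‖ := h1
      _ = ‖f'‖ / 2 * ρ := by rw [hn]
      _ < ‖f'‖ * ρ := by nlinarith [norm_pos_iff.2 hf'ne]
  have hwg : wind (fun t => f' * circleLoop 0 ρ t) = 1 := by
    rw [wind_mul (IsNonvanishingLoop.const hf'ne) (isNonvanishingLoop_circleLoop (by rw [norm_zero, abs_of_pos hρpos]; exact hρpos.ne)),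
      wind_const, wind_circleLoop_zero hρpos, zero_add]
  rw [← wind_congr hH1, ← hhom, wind_congr hH0, hsmall, hwg]

/-! ### Re-parametrising a Jordan domain by a map of the closed disc -/

/-- The unit circle loop is injective on `[0, 1)`. [folklore] -/
theorem injOn_circleLoop_zero_one : InjOn (circleLoop 0 1) (Ico 0 1) := by
  intro s hs t ht h
  have hinj := injOn_circleMap_of_abs_sub_le' (c := (0 : ℂ)) (a := 0) (b := 2 * Real.pi) one_ne_zero (by simp)
  have key : 2 * Real.pi * s = 2 * Real.pi * t :=
    hinj ⟨by nlinarith [Real.pi_pos, hs.1], by nlinarith [Real.pi_pos, hs.2]⟩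
      ⟨by nlinarith [Real.pi_pos, ht.1], by nlinarith [Real.pi_pos, ht.2]⟩ h
  exact mul_left_cancel₀ (by positivity) key

/-- The range of the unit circle loop is the unit circle. [folklore] -/
theorem range_circleLoop_zero_one : range (circleLoop (0 : ℂ) 1) = sphere 0 1 := by
  have hs : Function.Surjective fun t : ℝ => 2 * Real.pi * t := fun y =>
    ⟨y / (2 * Real.pi), by field_simp⟩
  rw [show circleLoop (0 : ℂ) 1 = circleMap 0 1 ∘ fun t : ℝ => 2 * Real.pi * t from rfl,
    hs.range_comp, range_circleMap, abs_one]

/-- **A Jordan domain re-parametrised by a map of the circle onto its frontier**: there is a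
Jordan domain with the same carrier and boundary loop `t ↦ Φ (e^{2πit})`, for `Φ` continuous on
the closed unit disc and bijective from the unit circle onto the frontier (e.g. the Carathéodory
extension of a conformal map of the disc, Pommerenke 1992, Thm. 2.6). [folklore] -/
theorem exists_ofDiscMap (D : JordanDomain) (Φ : ℂ → ℂ) (hc : ContinuousOn Φ (closedBall 0 1))
    (hb : BijOn Φ (sphere 0 1) (frontier D.carrier)) :
    ∃ D' : JordanDomain, D'.carrier = D.carrier ∧ D'.boundary = fun t => Φ (circleLoop 0 1 t) := by
  refine ⟨{ carrier := D.carrier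
            boundary := fun t => Φ (circleLoop 0 1 t)
            isOpen := D.isOpen
            isBounded := D.isBounded
            isConnected := D.isConnected
            continuous_boundary :=
              hc.comp_continuous (continuous_circleLoop 0 1) fun t =>
                sphere_subset_closedBall (circleLoop_mem_sphere 0 zero_le_one t)
            periodic_boundary := fun t => ?_
            injOn_boundary := fun s hs t ht h =>
              injOn_circleLoop_zero_one hs ht
                (hb.injOn (circleLoop_mem_sphere 0 zero_le_one s) (circleLoop_mem_sphere 0 zero_le_one t) h)
            range_boundary := ?_ }, rfl, rfl⟩
  · simp only
    rw [circleLoop_apply, circleLoop_apply]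
    congr 2
    push_cast
    rw [show 2 * (Real.pi : ℂ) * (t + 1) * I = 2 * Real.pi * t * I + 2 * Real.pi * I by ring,
      exp_add, exp_two_pi_mul_I, mul_one]
  · rw [show (fun t => Φ (circleLoop 0 1 t)) = Φ ∘ circleLoop 0 1 from rfl, range_comp,
      range_circleLoop_zero_one, hb.image_eq]

/-- **The re-parametrisation by a Carathéodory extension is positively oriented**: a Jordan
domain whose boundary loop is `t ↦ Φ (e^{2πit})`, `Φ` the continuous injective extension to
the closed disc of a conformal map `φ` of the disc onto the domain, has index `1` on the
domain. [folklore] -/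
theorem index_eq_one_of_boundary_eq (D D' : JordanDomain) (φ : ConformalEquiv (ball (0 : ℂ) 1) D.carrier)
    {Φ : ℂ → ℂ} (hc : ContinuousOn Φ (closedBall 0 1)) (he : EqOn Φ φ (ball 0 1))
    (hi : InjOn Φ (closedBall 0 1)) (hD' : D'.carrier = D.carrier)
    (hb' : D'.boundary = fun t => Φ (circleLoop 0 1 t)) {z : ℂ} (hz : z ∈ D.carrier) :
    D'.index z = 1 := by
  have h0 : φ 0 ∈ D'.carrier := by rw [hD']; exact φ.mapsTo (mem_ball_self one_pos)
  have hz' : z ∈ D'.carrier := by rw [hD']; exact hz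
  rw [D'.index_eq_of_mem_carrier hz' h0, index, hb']
  exact D.wind_boundary_extension φ hc he hi

/-! ### The index of a Jordan domain is `±1` -/

/-- **The index of the boundary loop of a Jordan domain about an interior point is `±1`.** By
the Riemann mapping theorem and Carathéodory's theorem the frontier is also parametrised by the
boundary extension of a conformal map of the disc, a loop of index `1`
(`index_ofDiscMap_eq_one`); the given loop differs from it by a circle homeomorphism of degree
`±1` (`exists_lift`, `index_eq_mul_index`). [folklore] -/
theorem index_eq_one_or_eq_neg_one (D : JordanDomain) {z : ℂ} (hz : z ∈ D.carrier) :
    D.index z = 1 ∨ D.index z = -1 := by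
  obtain ⟨φ₀⟩ := exists_conformalEquiv_ball_holds (U := D.carrier) D.isOpen D.isSimplyConnected_carrier
    D.carrier_ne_univ
  set φ := φ₀.symm
  obtain ⟨Φ, hc, he, hbij, hbij'⟩ := exists_continuousOn_extension_holds D φ
  obtain ⟨D₂, hD₂, hD₂b⟩ := D.exists_ofDiscMap Φ hc hbij'
  have h2 : D₂.index z = 1 := index_eq_one_of_boundary_eq D D₂ φ hc he hbij.injOn hD₂ hD₂b hz
  obtain ⟨σ, hσc, hσ, hcase⟩ := exists_lift D D₂ hD₂.symm
  have hzf : z ∉ frontier D₂.carrier := fun h =>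
    (Set.disjoint_left.1 D.disjoint_carrier_frontier) hz (hD₂ ▸ h)
  rcases hcase with ⟨-, h1⟩ | ⟨-, h1⟩
  · left
    have := index_eq_mul_index D D₂ hσc hσ (n := 1) (by rw [h1]; simp) hzf
    rw [this, h2]; simp
  · right
    have := index_eq_mul_index D D₂ hσc hσ (n := -1) (by rw [h1]; simp [sub_eq_add_neg]) hzf
    rw [this, h2]; simp

end JordanDomain

end Literature.Probability.RandomPlanarGeometry

end
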